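import Literature.NumberTheory.EllipticCurves.PAdicLFunctionQuadraticTwistBirchProofs
import Literature.NumberTheory.EllipticCurves.PAdicLFunctionTameCongruenceAtTwoAutoProofs
import HarnessLib

/-!
# The mod-`2` twist congruence of the analytic Kida formula: `L₂(f_{E^{(d)}}, α') ≐ L₂(f_E, α)·∏_{ℓ∣d} 𝒫_ℓ (mod 2Λ)`
# (Matsuno 2000, proof of Thm. 3.1 = Lemmas 3.2–3.3, read at `p = 2`), PROOFS ONLY

A *proofs* file (theorems only: no definition, no named fact, no axiom), the `p = 2` sequel of
`PAdicLFunctionQuadraticTwistBirchProofs` (Birch's lemma `L_p(f_A, α_A) = C(c)·(1+T)^{−f_m}·L_p(f_W, m, α_W, χ_d)`, `c ≠ 0`).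
For EVERY `E = W/ℚ` globally minimal and good ordinary at `2` (no hypothesis on `E[2]`), `d > 0`, `d ≡ 1 (mod 4)` squarefree and
prime to `N_E`, `A` a globally minimal model of `E^{(d)}`, newforms `f_W`, `f_A`, and `S₀` the places over the primes of `d`:

* **`exists_iwasawa_twist_congr_two`** — there are `L_W, L_A' ∈ Λ = ℤ₂⟦T⟧`, `c_A ∈ ℚˣ`, `v ∈ Λˣ` with
  `ι L_W = L₂(f_W, α_W)`, `ι L_A' = C(c_A)·L₂(f_A, α_A)` and `L_A' ≡ v · L_W · ∏_{v∈S₀} 𝒫_v (mod 2Λ)`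
  (`𝒫_v` = Greenberg–Vatsal's Euler factor, `GreenbergVatsal2000.eulerFactorProduct`): Birch's lemma with the unit
  `(1+T)^{−f_m} ∈ Λˣ`, composed with `exists_iwasawa_padicLFunctionTame_congr_two_auto`
  (`PAdicLFunctionTameCongruenceAtTwoAutoProofs`: `L₂(f_W, m, α_W, χ_d) ≡ u·L₂(f_W, α_W)·∏𝒫_v (mod 2)` — Matsuno's Lemma 3.2,
  `χ_d ≡ 𝟙 (mod 2)` on a `½ℤ₂`-valued EVEN tame measure with the `Δ`-doubling, and Lemma 3.3, the exact Euler-factor identity, at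
  `p = 2`; the `E[2]`-irreducibility of the tree's first version is not needed: INT2-AUTO at tame level).

This is the displayed congruence `hcong` of `Summits/…/Theorems/TwoAdicConverseKidaAnalyticOfCongruence.lean` for the
canonical integral lift `L_W` of `L₂(f_W, α_W)`; the Summits side turns it into the analytic Kida formula at `2`.
Everything is proved; nothing is asserted; the normalisations are the tree's (`Ω⁺_f`).

## References

* K. Matsuno, J. Number Theory 84 (2000) 80–92, Lemmas 3.2–3.3 and proof of Thm. 3.1 (pp. 86–88). [Matsuno2000]
* B. Mazur, J. Tate, J. Teitelbaum, Invent. Math. 84 (1986), §I.8. [MazurTateTeitelbaum1986Invent]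
* R. Greenberg, V. Vatsal, Invent. Math. 142 (2000), §1 display (8)–(9), §2 Prop. (2.4). [GreenbergVatsal2000]
-/

noncomputable section

open scoped MatrixGroups ModularForm NumberTheorySymbols

open CongruenceSubgroup NumberField IsDedekindDomain WeierstrassCurve PowerSeries
  Literature.NumberTheory.EllipticCurves.ModularForms Literature.NumberTheory.EllipticCurves.GreenbergVatsal2000

namespace Literature.NumberTheory.EllipticCurves

section TwoAdic

variable (W : WeierstrassCurve ℚ) [W.IsElliptic] [W.IsGloballyMinimal] {d : ℤ} {A : WeierstrassCurve ℚ}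
  [A.IsElliptic] [A.IsGloballyMinimal]
  [NeZero (W.conductorNorm ℤ)] [NeZero (A.conductorNorm ℤ)]
  {fW : CuspForm (Gamma0 (W.conductorNorm ℤ)) 2} {fA : CuspForm (Gamma0 (A.conductorNorm ℤ)) 2}

omit [W.IsElliptic] [W.IsGloballyMinimal] [NeZero (W.conductorNorm ℤ)] in
/-- Distinct finite places of `ℚ` lie over distinct primes; private helper. [folklore] -/
private theorem natGenerator_injective_rat' :
    Function.Injective (Rat.HeightOneSpectrum.natGenerator (R := 𝓞 ℚ)) := fun _ _ h ↦
  (Rat.HeightOneSpectrum.primesEquiv (R := 𝓞 ℚ)).injective (Subtype.ext h)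

/-- **The mod-`2` twist congruence** (Matsuno 2000, proof of Thm. 3.1 = Lemmas 3.2 + 3.3, READ AT `p = 2`, with
Birch's lemma, `exists_padicLFunction_twist_eq_C_mul_padicLFunctionTame`): for `E = W/ℚ` globally minimal, good ordinary at `2` (NO hypothesis on `E[2]`), `d > 0`,
`d ≡ 1 (mod 4)` squarefree and prime to `N_E`, `A` a globally minimal model of `E^{(d)}`, newforms `f_W`, `f_A`, and
`S₀` the set of places over the primes dividing `d`: there are `L_W, L_A' ∈ Λ = ℤ₂⟦T⟧`, `c_A ∈ ℚˣ` and `v ∈ Λˣ` with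
`ι L_W = L₂(f_W, α_W)`, `ι L_A' = C(c_A)·L₂(f_A, α_A)` and `L_A' ≡ v · L_W · ∏_{v∈S₀} 𝒫_v (mod 2Λ)`
(`𝒫_v` = Greenberg–Vatsal's Euler factor). Assembled from Birch's lemma (`L₂(f_A, α_A) = C(c)(1+T)^{−f}·L₂(f_W, m, α_W, χ_d)`,
`(1+T)^{−f} ∈ Λˣ`) and `exists_iwasawa_padicLFunctionTame_congr_two_auto`
(`L₂(f_W, m, α_W, χ_d) ≡ u·L₂(f_W,α_W)·∏𝒫_v`, no hypothesis on `E[2]`). [cite: Matsuno2000, Lemmas 3.2–3.3 and proof of Theorem 3.1 (pp. 86–88)]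
[cite: MazurTateTeitelbaum1986Invent, §I.8] -/
theorem exists_iwasawa_twist_congr_two (hmod : exists_isNewformOf) (hd : 0 < d) (hd4 : d % 4 = 1)
    (hsq : Squarefree d) (hcop : IsCoprime d (W.conductorNorm ℤ : ℤ)) {C : VariableChange ℚ}
    (hA : C • W.quadraticTwist (d : ℚ) = A) (hfW : IsNewformOf W fW) (hfA : IsNewformOf A fA)
    (hord : IsOrdinaryAt W 2) (S₀ : Finset (HeightOneSpectrum (𝓞 ℚ)))
    (hS₀ : S₀.image Rat.HeightOneSpectrum.natGenerator = d.natAbs.primeFactors) :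
    ∃ (LW LA' : IwasawaAlgebra 2) (cA : ℚ) (v : (IwasawaAlgebra 2)ˣ),
      iwasawaToPowerSeries 2 LW = padicLFunction fW (unitRoot W 2 : ℚ_[2]) ∧ cA ≠ 0 ∧
      iwasawaToPowerSeries 2 LA' = PowerSeries.C (cA : ℚ_[2]) * padicLFunction fA (unitRoot A 2 : ℚ_[2]) ∧
      PowerSeries.map (PadicInt.toZMod (p := 2)) LA' =
        PowerSeries.map (PadicInt.toZMod (p := 2)) ((v : IwasawaAlgebra 2) * LW * eulerFactorProduct W 2 S₀) := by
  have hd0 : d ≠ 0 := hd.ne'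
  haveI : NeZero d.natAbs := ⟨Int.natAbs_ne_zero.mpr hd0⟩
  have hmd : (d.natAbs : ℤ) = d := Int.natAbs_of_nonneg hd.le
  have hsq' : Squarefree d.natAbs := Int.squarefree_natAbs.mpr hsq
  have hm4 : d.natAbs % 4 = 1 := by omega
  have hd2 : ¬ (2 : ℤ) ∣ d := by omega
  obtain ⟨χ, hχ⟩ := exists_mulChar_int_eq_jacobiSym d.natAbs
  obtain ⟨c, hc0, hL⟩ :=
    exists_padicLFunction_twist_eq_C_mul_padicLFunctionTame W hmod hd hd4 hsq hcop hA hfW hfA hord hd2 hχ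
  set χ₂ : DirichletCharacter ℚ_[2] d.natAbs :=
    (χ.ringHomComp (Int.castRingHom ℚ)).ringHomComp (Rat.castHom ℚ_[2]) with hχ₂_def
  have hχ₂even : χ₂.Even := by
    show χ₂ (-1) = 1
    rw [hχ₂_def, MulChar.ringHomComp_apply, MulChar.ringHomComp_apply, mulChar_jacobi_apply_neg_one hχ hm4, map_one,
      map_one]
  have hχ₂sq : χ₂ ^ 2 = 1 := by
    have : χ₂ = χ.ringHomComp ((Rat.castHom ℚ_[2]).comp (Int.castRingHom ℚ)) := MulChar.ext' fun a ↦ rfl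
    rw [this]
    exact mulChar_jacobi_ringHomComp_sq hχ _
  -- the places over the primes of `d`
  have hS2 : ∀ v ∈ S₀, Rat.HeightOneSpectrum.natGenerator v ≠ 2 := by
    intro v hv h
    have hmem : Rat.HeightOneSpectrum.natGenerator v ∈ d.natAbs.primeFactors := hS₀ ▸ Finset.mem_image_of_mem _ hv
    rw [h] at hmem
    exact hd2 (Int.natCast_dvd.mpr (Nat.dvd_of_mem_primeFactors hmem))
  have hgood : ∀ v ∈ S₀, W.HasGoodReductionAt v := by
    intro v hv
    refine hasGoodReductionAt_of_not_dvd_conductorNorm W v fun hvN ↦ ?_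
    have hmem : Rat.HeightOneSpectrum.natGenerator v ∈ d.natAbs.primeFactors := hS₀ ▸ Finset.mem_image_of_mem _ hv
    have hℓ : (Rat.HeightOneSpectrum.natGenerator v).Prime := Nat.prime_of_mem_primeFactors hmem
    have hℓd : (Rat.HeightOneSpectrum.natGenerator v : ℤ) ∣ d := Int.natCast_dvd.mpr (Nat.dvd_of_mem_primeFactors hmem)
    have hu := Int.isUnit_iff_natAbs_eq.mp
      (hcop.isUnit_of_dvd' hℓd (Int.natCast_dvd_natCast.mpr hvN))
    rw [Int.natAbs_natCast] at hu
    exact hℓ.one_lt.ne' hu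
  have hm : d.natAbs = ∏ v ∈ S₀, Rat.HeightOneSpectrum.natGenerator v := by
    have h := Nat.prod_primeFactors_of_squarefree hsq'
    rw [← hS₀, Finset.prod_image fun v _ w _ h ↦ natGenerator_injective_rat' h] at h
    exact h.symm
  obtain ⟨LW, G, u, hLW, hG, hGc⟩ :=
    exists_iwasawa_padicLFunctionTame_congr_two_auto hord hfW S₀ hS2 hgood hm χ₂ hχ₂even hχ₂sq
  -- the unit `(1+T)^{−f_m}` of `Λ`
  set B : IwasawaAlgebra 2 := PowerSeries.binomialSeries ℤ_[2] (-frobeniusExponent 2 (d.natAbs : ℤ_[2])) with hB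
  have hBu : IsUnit B :=
    isUnit_iff_exists_inv.mpr ⟨PowerSeries.binomialSeries ℤ_[2] (frobeniusExponent 2 (d.natAbs : ℤ_[2])), by
      rw [hB, ← PowerSeries.binomialSeries_add, neg_add_cancel, PowerSeries.binomialSeries_zero]⟩
  have hcQ : (c : ℚ_[2]) ≠ 0 := by exact_mod_cast hc0
  refine ⟨LW, B * G, c⁻¹, hBu.unit * u, hLW, inv_ne_zero hc0, ?_, ?_⟩
  · rw [map_mul, hG, hB, BurungaleSkinner2023.iwasawaToPowerSeries_binomialSeries, hL, Rat.cast_inv, ← mul_assoc,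
      ← mul_assoc, ← map_mul, inv_mul_cancel₀ hcQ, map_one, one_mul]
  · rw [map_mul, hGc, ← map_mul, Units.val_mul, IsUnit.unit_spec]
    congr 1
    ring

end TwoAdic

end Literature.NumberTheory.EllipticCurves

end
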